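import Mathlib.Topology.Separation.DisjointCover
import Mathlib.Topology.Algebra.Support
import Mathlib.Topology.LocallyConstant.Basic
import Mathlib.Algebra.BigOperators.Group.Finset.Indicator
import Literature.Topology.LocallyConstantExtend
import HarnessLib

/-!
# Finite refinements by pairwise disjoint compact open sets (ℓ-spaces)

Topic `Topology`; namespace `Literature.Topology`. THEOREMS ONLY (no definition, no instance, no named
fact, no `sorry`).

Bernstein–Zelevinsky (1976), §1.1: in an `ℓ`-space (Hausdorff, locally compact, totally disconnected)
the compact open sets form a basis, and **every covering of a compact set `K` by open sets admits a
finite refinement by pairwise disjoint compact open sets** (Lemma 1.1 of loc. cit.; this is what makes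
`S(X)`, the locally constant compactly supported functions, behave like step functions: a test function
supported in `K` is the finite sum of its restrictions to the pieces).

Mathlib proves the absolute (profinite) case: an open cover of a compact, Hausdorff, totally
disconnected space has a finite refinement by pairwise disjoint nonempty clopen sets
(`TopologicalSpace.IsOpenCover.exists_finite_nonempty_disjoint_clopen_cover`). We transport it to the
relative situation met in harmonic analysis on `p`-adic groups:

* `exists_finite_disjoint_compactOpen_cover_of_isCompact_isOpen` — a compact open `C`, covered by open
  sets `U i`, is the DISJOINT UNION of finitely many nonempty compact open sets each inside some `U i`
  (no local compactness needed: `C` itself is a profinite space);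
* `exists_finite_disjoint_compactOpen_cover_of_isCompact` — Bernstein–Zelevinsky's Lemma 1.1 for an
  arbitrary compact `K` of a locally compact Hausdorff totally disconnected space (through a compact
  open neighbourhood of `K` inside the union of the cover, `exists_isCompact_isOpen_superset_subset`);
* `eq_sum_indicator_of_subset_iUnion` — a function supported in a disjoint union `⋃ j, V j` is the sum
  of its pieces `(V j).indicator f`; the pieces of a locally constant, compactly supported `f` along
  compact open `V j` are again locally constant and compactly supported
  (`isLocallyConstant_indicator_of_isClopen`, `hasCompactSupport_indicator_of_isCompact`), and are
  supported in `V j`;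
* `exists_finite_sum_indicator_compactOpen_subordinate` — the packaged form used for regular-support
  test functions: `f` locally constant with compact support inside an open set covered by open sets
  `U i` is a finite sum `f = ∑ j, f_j` of locally constant compactly supported `f_j`, each supported in a
  compact open subset of a single `U i`, the supports pairwise disjoint.

## References

* [BernsteinZelevinsky1976] I. N. Bernstein, A. V. Zelevinsky, *Representations of the group GL(n, F)
  where F is a non-archimedean local field*, Russian Math. Surveys 31:3 (1976), §1.1 (ℓ-spaces,
  Lemma 1.1) and §1.3 (`S(X)`).
-/

open Set Filter Topology Function

namespace Literature.Topology

section Refinement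

variable {G : Type*} [TopologicalSpace G] [T2Space G] [TotallyDisconnectedSpace G]

/-- **A compact open set covered by open sets is a finite disjoint union of nonempty compact open sets
subordinate to the cover.** `G` Hausdorff and totally disconnected, `C ⊆ G` compact and open,
`C ⊆ ⋃ i, U i` with all `U i` open: there are finitely many pairwise disjoint nonempty compact open
sets `V j`, each contained in `C ∩ U i` for some `i`, with `⋃ j, V j = C`. (The subspace `C` is
profinite; Mathlib's `exists_finite_nonempty_disjoint_clopen_cover` there, pushed forward along the open
embedding `C ↪ G`.) [cite: BernsteinZelevinsky1976, §1.1] -/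
theorem exists_finite_disjoint_compactOpen_cover_of_isCompact_isOpen {ι : Type*} {C : Set G}
    (hCc : IsCompact C) (hCo : IsOpen C) (U : ι → Set G) (hU : ∀ i, IsOpen (U i))
    (hCU : C ⊆ ⋃ i, U i) :
    ∃ (n : ℕ) (V : Fin n → Set G), (∀ j, IsCompact (V j) ∧ IsOpen (V j) ∧ (V j).Nonempty ∧
      V j ⊆ C ∧ ∃ i, V j ⊆ U i) ∧ Pairwise (Disjoint on V) ∧ ⋃ j, V j = C := by
  classical
  haveI : CompactSpace C := isCompact_iff_compactSpace.1 hCc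
  -- the cover of the subspace `C` by the traces of the `U i`
  let U' : ι → TopologicalSpace.Opens C :=
    fun i => ⟨((↑) : C → G) ⁻¹' U i, (hU i).preimage continuous_subtype_val⟩
  have hU' : TopologicalSpace.IsOpenCover U' := by
    rw [TopologicalSpace.IsOpenCover, eq_top_iff]
    rintro ⟨x, hx⟩ -
    obtain ⟨i, hi⟩ := mem_iUnion.1 (hCU hx)
    exact TopologicalSpace.Opens.mem_iSup.2 ⟨i, hi⟩
  obtain ⟨n, W, hW, hWcov, hWd⟩ := hU'.exists_finite_nonempty_disjoint_clopen_cover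
  refine ⟨n, fun j => ((↑) : C → G) '' (W j : Set C), fun j => ⟨?_, ?_, ?_, ?_, ?_⟩, ?_, ?_⟩
  · exact ((W j).isClopen.1.isCompact).image continuous_subtype_val
  · exact hCo.isOpenMap_subtype_val _ (W j).isClopen.2
  · have hne : (W j : Set C).Nonempty := by
      rw [Set.nonempty_iff_ne_empty]
      intro h
      exact (hW j).1 (SetLike.coe_injective (by simpa using h))
    exact hne.image _
  · rintro _ ⟨x, -, rfl⟩
    exact x.2
  · obtain ⟨i, hi⟩ := (hW j).2
    exact ⟨i, by rintro _ ⟨x, hx, rfl⟩; exact hi hx⟩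
  · intro j k hjk
    exact (Set.disjoint_image_iff Subtype.val_injective).2
      (TopologicalSpace.Clopens.coe_disjoint.2 (hWd hjk))
  · apply Subset.antisymm
    · exact iUnion_subset fun j => by rintro _ ⟨x, -, rfl⟩; exact x.2
    · intro x hx
      obtain ⟨j, hj⟩ := mem_iUnion.1 (hWcov (mem_univ (⟨x, hx⟩ : C)))
      exact mem_iUnion.2 ⟨j, ⟨⟨x, hx⟩, hj, rfl⟩⟩

/-- **Bernstein–Zelevinsky's Lemma 1.1.** In a locally compact Hausdorff totally disconnected space,
every covering of a compact set `K` by open sets `U i` admits a finite refinement by pairwise disjoint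
nonempty compact open sets: `K ⊆ ⋃ j, V j`, each `V j ⊆ U i` for some `i`.
[cite: BernsteinZelevinsky1976, §1.1] -/
theorem exists_finite_disjoint_compactOpen_cover_of_isCompact [LocallyCompactSpace G] {ι : Type*}
    {K : Set G} (hK : IsCompact K) (U : ι → Set G) (hU : ∀ i, IsOpen (U i)) (hKU : K ⊆ ⋃ i, U i) :
    ∃ (n : ℕ) (V : Fin n → Set G), (∀ j, IsCompact (V j) ∧ IsOpen (V j) ∧ (V j).Nonempty ∧
      ∃ i, V j ⊆ U i) ∧ Pairwise (Disjoint on V) ∧ K ⊆ ⋃ j, V j := by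
  obtain ⟨C, hCc, hCo, hKC, hCU⟩ :=
    exists_isCompact_isOpen_superset_subset hK (isOpen_iUnion hU) hKU
  obtain ⟨n, V, hV, hVd, hVC⟩ :=
    exists_finite_disjoint_compactOpen_cover_of_isCompact_isOpen hCc hCo U hU hCU
  exact ⟨n, V, fun j => ⟨(hV j).1, (hV j).2.1, (hV j).2.2.1, (hV j).2.2.2.2⟩, hVd, hVC.symm ▸ hKC⟩

end Refinement

section Pieces

variable {G : Type*} {M : Type*} [AddCommMonoid M]

/-- **A function supported in a finite disjoint union is the sum of its pieces**:
`support f ⊆ ⋃ j, V j` with the `V j` pairwise disjoint gives `f = ∑ j, 1_{V j} · f`.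
[cite: BernsteinZelevinsky1976, §1.3] -/
theorem eq_sum_indicator_of_subset_iUnion {n : ℕ} (V : Fin n → Set G) (hVd : Pairwise (Disjoint on V))
    (f : G → M) (hf : support f ⊆ ⋃ j, V j) : f = fun x => ∑ j, (V j).indicator f x := by
  classical
  have hpd : ((Finset.univ : Finset (Fin n)) : Set (Fin n)).PairwiseDisjoint V :=
    fun j _ k _ hjk => hVd hjk
  have h := Finset.indicator_biUnion (Finset.univ : Finset (Fin n)) V (f := f) hpd
  have hU : (⋃ j ∈ (Finset.univ : Finset (Fin n)), V j) = ⋃ j, V j := by simp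
  rw [hU] at h
  rw [← h, eq_comm, indicator_eq_self]
  exact hf

/-- Pointwise form of `eq_sum_indicator_of_subset_iUnion`. [cite: BernsteinZelevinsky1976, §1.3] -/
theorem sum_indicator_apply_eq_of_subset_iUnion {n : ℕ} (V : Fin n → Set G)
    (hVd : Pairwise (Disjoint on V)) (f : G → M) (hf : support f ⊆ ⋃ j, V j) (x : G) :
    ∑ j, (V j).indicator f x = f x :=
  (congrFun (eq_sum_indicator_of_subset_iUnion V hVd f hf) x).symm

/-- On the piece `V k` only the `k`-th term survives: `(V k).indicator f x = f x` for `x ∈ V k`, and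
the other pieces vanish there. [cite: BernsteinZelevinsky1976, §1.3] -/
theorem indicator_apply_eq_zero_of_mem_of_ne {n : ℕ} (V : Fin n → Set G)
    (hVd : Pairwise (Disjoint on V)) (f : G → M) {j k : Fin n} (hjk : j ≠ k) {x : G} (hx : x ∈ V k) :
    (V j).indicator f x = 0 :=
  indicator_of_notMem (fun hxj => Set.disjoint_left.1 (hVd hjk) hxj hx) _

/-- The piece `1_V · f` is supported in `V`. [cite: BernsteinZelevinsky1976, §1.3] -/
theorem support_indicator_subset' (V : Set G) (f : G → M) : support (V.indicator f) ⊆ V :=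
  support_indicator_subset

variable [TopologicalSpace G]

/-- **The piece of a locally constant function along a clopen set is locally constant.**
[cite: BernsteinZelevinsky1976, §1.3] -/
theorem isLocallyConstant_indicator_of_isClopen {V : Set G} (hV : IsClopen V) {f : G → M}
    (hf : IsLocallyConstant f) : IsLocallyConstant (V.indicator f) :=
  (LocallyConstant.indicator ⟨f, hf⟩ hV).isLocallyConstant

/-- **The piece of any function along a compact (closed) set has compact support** (Hausdorff ambient
space). [cite: BernsteinZelevinsky1976, §1.3] -/
theorem hasCompactSupport_indicator_of_isCompact [T2Space G] {V : Set G} (hV : IsCompact V)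
    (f : G → M) : HasCompactSupport (V.indicator f) :=
  HasCompactSupport.intro hV fun _ hx => indicator_of_notMem hx _

/-- The topological support of the piece along a compact set `V` lies in `V` (Hausdorff ambient space).
[cite: BernsteinZelevinsky1976, §1.3] -/
theorem tsupport_indicator_subset_of_isCompact [T2Space G] {V : Set G} (hV : IsCompact V)
    (f : G → M) : tsupport (V.indicator f) ⊆ V :=
  closure_minimal support_indicator_subset hV.isClosed

end Pieces

section Package

variable {G : Type*} [TopologicalSpace G] [T2Space G] [TotallyDisconnectedSpace G]
  [LocallyCompactSpace G] {M : Type*} [AddCommMonoid M]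

/-- **Decomposition of a test function subordinate to an open cover of its support.** `G` locally
compact, Hausdorff, totally disconnected; `f : G → M` locally constant with compact support, its
support covered by open sets `U i`. Then `f = ∑ j, f j` for finitely many locally constant, compactly
supported `f_j := 1_{V j} · f`, where the `V j` are pairwise disjoint nonempty compact open sets each
inside a single `U i`, and `tsupport f_j ⊆ V j`. (Bernstein–Zelevinsky's Lemma 1.1 applied to the
compact support; the form in which orbital integrals and transfer statements, additive in `f`, are
reduced to test functions supported in one chart.) [cite: BernsteinZelevinsky1976, §1.1] -/
theorem exists_finite_sum_indicator_compactOpen_subordinate {ι : Type*} {f : G → M}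
    (hflc : IsLocallyConstant f) (hfc : HasCompactSupport f) (U : ι → Set G) (hU : ∀ i, IsOpen (U i))
    (hfU : tsupport f ⊆ ⋃ i, U i) :
    ∃ (n : ℕ) (V : Fin n → Set G), (∀ j, IsCompact (V j) ∧ IsOpen (V j) ∧ (V j).Nonempty ∧
      ∃ i, V j ⊆ U i) ∧ Pairwise (Disjoint on V) ∧ tsupport f ⊆ ⋃ j, V j ∧
      (f = fun x => ∑ j, (V j).indicator f x) ∧
      (∀ j, IsLocallyConstant ((V j).indicator f) ∧ HasCompactSupport ((V j).indicator f) ∧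
        tsupport ((V j).indicator f) ⊆ V j) := by
  obtain ⟨n, V, hV, hVd, hfV⟩ :=
    exists_finite_disjoint_compactOpen_cover_of_isCompact hfc U hU hfU
  refine ⟨n, V, hV, hVd, hfV,
    eq_sum_indicator_of_subset_iUnion V hVd f ((subset_tsupport f).trans hfV), fun j => ⟨?_, ?_, ?_⟩⟩
  · exact isLocallyConstant_indicator_of_isClopen ⟨(hV j).1.isClosed, (hV j).2.1⟩ hflc
  · exact hasCompactSupport_indicator_of_isCompact (hV j).1 f
  · exact tsupport_indicator_subset_of_isCompact (hV j).1 f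

end Package

end Literature.Topology
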